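import Mathlib
import Literature.Analysis.OperatorTheory.L2KernelIntegralOperator
import Literature.Analysis.OperatorTheory.PositivityImproving
import Literature.Analysis.OperatorTheory.SupNormCompactOperator
import Literature.Analysis.OperatorTheory.IntegralOperatorHilbertSchmidt
import Summits.RiemannHypothesis.RiemannHypothesis.Theorems.SuzukiWindowsDoorTemple
import Summits.RiemannHypothesis.RiemannHypothesis.Theorems.SuzukiWindowsDoorTempleGalerkin
import HarnessLib

/-!
# Temple's certificate for the window operator on `L²(−t,t)`, assembled from Galerkin data (RH-free, K-general)

The window operator `𝖪[t]` as ANY bounded operator `A` on `L²(S)`, `S = (−t,t)`, with the a.e. kernel formula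
`(Aφ)(x) = ∫_S K(x+y)φ(y)dy` (one exists by the tree's generic `Literature.Analysis.OperatorTheory` package, which also
gives compactness, symmetry and `⟪ψ, Aφ⟫ = ∫_S ψ ∫_S K φ`); the codimension-one functional `L g = Σ uᵢ ∫_S φᵢ g` of a
Galerkin deflation (built locally); the Ritz function `u_S = Σ uᵢ φᵢ`; and the assembled THEOREM
`quadForm_le_of_temple_galerkin_certificate`: the deflated Galerkin certificate `(φ, M, u, a₀, δ)` of
`SuzukiWindowsDoorTempleGalerkin` plus three certified integrals of the Ritz function (`η₁ ≤ ∫ u_S 𝖪u_S ≤ η₂`,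
`∫ (𝖪u_S)² ≤ ρ₂`) with `a₀ + δ < η₁`, `0 < η₁` bound the WHOLE quadratic form:
`∫_S f 𝖪f ≤ (η₂ + (ρ₂ − η₁²)/(η₁ − a₀ − δ)) ∫_S f²` for every `f ∈ L²(S)` — Temple's inequality with the remainder
squared, the logic of the rh-dbr ET1e sharp (Temple-route) legs (DATA.md §ET1e).  No new definitions.
RH-FREE; nothing here bears on the truth of RH.

References: G. Temple, Proc. R. Soc. A 119 (1928); T. Kato, J. Phys. Soc. Japan 4 (1949); M. Reed, B. Simon,
Methods of Modern Mathematical Physics I (1980), Thm VI.23; IV (1978), Thm XIII.44.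
-/

set_option linter.dupNamespace false

noncomputable section

open MeasureTheory Set Function
open scoped RealInnerProductSpace

namespace Summit.RiemannHypothesis.RiemannHypothesis.Theorems.SuzukiWindowsDoorTempleGalerkin

open Literature.Analysis.OperatorTheory
open Summit.RiemannHypothesis.RiemannHypothesis.Theorems.SuzukiWindowsDoorTemple

variable {K : ℝ → ℝ}

/-- The Hankel kernel `(x,y) ↦ K(x+y)` is in `L²(S × S)` for continuous `K` (bounded on the square). [folklore] -/
theorem memLp_winKernel (hK : Continuous K) (t : ℝ) :
    MemLp (uncurry fun x y : ℝ => K (x + y)) 2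
      ((volume.restrict (Ioo (-t) t)).prod (volume.restrict (Ioo (-t) t))) := by
  obtain ⟨CK, hCK⟩ := (isCompact_Icc : IsCompact (Icc (-(2 * |t|)) (2 * |t|))).exists_bound_of_continuousOn
    hK.continuousOn
  have hmeas : AEStronglyMeasurable (uncurry fun x y : ℝ => K (x + y))
      ((volume.restrict (Ioo (-t) t)).prod (volume.restrict (Ioo (-t) t))) :=
    (hK.comp (continuous_fst.add continuous_snd)).aestronglyMeasurable
  refine MemLp.of_bound hmeas CK ?_
  have hS : ∀ᵐ z ∂((volume.restrict (Ioo (-t) t)).prod (volume.restrict (Ioo (-t) t))),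
      z ∈ Ioo (-t) t ×ˢ Ioo (-t) t := by
    rw [Measure.prod_restrict]
    exact ae_restrict_mem (measurableSet_Ioo.prod measurableSet_Ioo)
  filter_upwards [hS] with z hz
  rcases hz with ⟨hx, hy⟩
  exact hCK (z.1 + z.2) ⟨by nlinarith [hx.1, hy.1, le_abs_self t, neg_abs_le t], by nlinarith [hx.2, hy.2, le_abs_self t]⟩

/-- A bounded window operator with the kernel formula exists on `L²(S)`. -/
theorem exists_winOp (hK : Continuous K) (t : ℝ) :
    ∃ A : Lp ℝ 2 (volume.restrict (Ioo (-t) t)) →L[ℝ] Lp ℝ 2 (volume.restrict (Ioo (-t) t)),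
      ∀ φ : Lp ℝ 2 (volume.restrict (Ioo (-t) t)),
        (A φ : ℝ → ℝ) =ᵐ[volume.restrict (Ioo (-t) t)] fun x => ∫ y in Ioo (-t) t, K (x + y) * φ y :=
  exists_l2KernelOp (memLp_winKernel hK t)

section Window

variable {t : ℝ} {A : Lp ℝ 2 (volume.restrict (Ioo (-t) t)) →L[ℝ] Lp ℝ 2 (volume.restrict (Ioo (-t) t))}

/-- Any window operator with the kernel formula is compact (Hilbert–Schmidt kernel). -/
theorem isCompactOperator_winOp (hK : Continuous K)
    (hA : ∀ φ, (A φ : ℝ → ℝ) =ᵐ[volume.restrict (Ioo (-t) t)] fun x => ∫ y in Ioo (-t) t, K (x + y) * φ y) :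
    IsCompactOperator A :=
  isCompactOperator_l2KernelOp (memLp_winKernel hK t) hA

/-- … and symmetric: `⟪Aφ, ψ⟫ = ⟪φ, Aψ⟫` (symmetric kernel). -/
theorem winOp_symm (hK : Continuous K)
    (hA : ∀ φ, (A φ : ℝ → ℝ) =ᵐ[volume.restrict (Ioo (-t) t)] fun x => ∫ y in Ioo (-t) t, K (x + y) * φ y)
    (φ ψ : Lp ℝ 2 (volume.restrict (Ioo (-t) t))) : ⟪A φ, ψ⟫ = ⟪φ, A ψ⟫ := by
  have h := isSelfAdjoint_l2KernelOp (memLp_winKernel hK t) (fun x y => by simp only [add_comm]) hA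
  exact (ContinuousLinearMap.isSelfAdjoint_iff_isSymmetric.1 h) φ ψ

/-- The quadratic form at the class of `g ∈ ℒ²(S)` is the window double integral of `g`. -/
theorem inner_winOp_toLp
    (hA : ∀ φ, (A φ : ℝ → ℝ) =ᵐ[volume.restrict (Ioo (-t) t)] fun x => ∫ y in Ioo (-t) t, K (x + y) * φ y)
    {g : ℝ → ℝ} (hg : MemLp g 2 (volume.restrict (Ioo (-t) t))) :
    ⟪A (hg.toLp g), hg.toLp g⟫ = ∫ x in Ioo (-t) t, g x * ∫ y in Ioo (-t) t, K (x + y) * g y := by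
  rw [real_inner_comm, inner_kernelOp_eq_integral hA]
  have hin : ∀ x, ∫ y in Ioo (-t) t, K (x + y) * (hg.toLp g) y = ∫ y in Ioo (-t) t, K (x + y) * g y :=
    fun x => integral_congr_ae (by filter_upwards [hg.coeFn_toLp] with y hy; rw [hy])
  refine integral_congr_ae ?_
  filter_upwards [hg.coeFn_toLp] with x hx
  rw [hx, hin x]

/-- The quadratic form at `g ∈ L²(S)`. -/
theorem inner_winOp_eq
    (hA : ∀ φ, (A φ : ℝ → ℝ) =ᵐ[volume.restrict (Ioo (-t) t)] fun x => ∫ y in Ioo (-t) t, K (x + y) * φ y)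
    (g : Lp ℝ 2 (volume.restrict (Ioo (-t) t))) :
    ⟪A g, g⟫ = ∫ x in Ioo (-t) t, g x * ∫ y in Ioo (-t) t, K (x + y) * g y := by
  rw [real_inner_comm]; exact inner_kernelOp_eq_integral hA g g

/-- `‖A[g]‖² = ∫_S (∫_S K(x+y) g(y) dy)² dx` at the class of `g`. -/
theorem norm_winOp_toLp_sq
    (hA : ∀ φ, (A φ : ℝ → ℝ) =ᵐ[volume.restrict (Ioo (-t) t)] fun x => ∫ y in Ioo (-t) t, K (x + y) * φ y)
    {g : ℝ → ℝ} (hg : MemLp g 2 (volume.restrict (Ioo (-t) t))) :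
    ‖A (hg.toLp g)‖ ^ 2 = ∫ x in Ioo (-t) t, (∫ y in Ioo (-t) t, K (x + y) * g y) ^ 2 := by
  rw [norm_sq_eq_integral_norm_sq]
  refine integral_congr_ae ?_
  filter_upwards [hA (hg.toLp g)] with x hx
  have : ∫ y in Ioo (-t) t, K (x + y) * (hg.toLp g) y = ∫ y in Ioo (-t) t, K (x + y) * g y :=
    integral_congr_ae (by filter_upwards [hg.coeFn_toLp] with y hy; rw [hy])
  rw [hx, Real.norm_eq_abs, sq_abs, this]

end Window

/-! ## Bounded measurable test functions against `L²(S)` -/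

section Galerkin

variable {t : ℝ} {n : ℕ} {φ : Fin n → ℝ → ℝ} {B : ℝ}

/-- `∫_S φᵢ g` is additive in `g ∈ L²(S)` (bounded `φᵢ`). -/
theorem integral_mul_Lp_add (hφm : ∀ i, Measurable (φ i)) (hφb : ∀ i x, |φ i x| ≤ B) (i : Fin n)
    (g h : Lp ℝ 2 (volume.restrict (Ioo (-t) t))) :
    ∫ x in Ioo (-t) t, φ i x * (g + h : Lp ℝ 2 (volume.restrict (Ioo (-t) t))) x =
      (∫ x in Ioo (-t) t, φ i x * g x) + ∫ x in Ioo (-t) t, φ i x * h x := by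
  have hφae : AEStronglyMeasurable (φ i) (volume.restrict (Ioo (-t) t)) := (hφm i).aestronglyMeasurable
  have hφbd : ∀ᵐ x ∂(volume.restrict (Ioo (-t) t)), ‖φ i x‖ ≤ B := Filter.Eventually.of_forall fun x => by
    rw [Real.norm_eq_abs]; exact hφb i x
  have hg1 : Integrable (fun x => φ i x * g x) (volume.restrict (Ioo (-t) t)) :=
    ((Lp.memLp g).integrable one_le_two).bdd_mul hφae hφbd
  have hh1 : Integrable (fun x => φ i x * h x) (volume.restrict (Ioo (-t) t)) :=
    ((Lp.memLp h).integrable one_le_two).bdd_mul hφae hφbd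
  rw [← integral_add hg1 hh1]
  refine integral_congr_ae ?_
  filter_upwards [Lp.coeFn_add g h] with x hx
  rw [hx, Pi.add_apply, mul_add]

/-- `∫_S φᵢ (c g) = c ∫_S φᵢ g`. -/
theorem integral_mul_Lp_smul (i : Fin n) (c : ℝ) (g : Lp ℝ 2 (volume.restrict (Ioo (-t) t))) :
    ∫ x in Ioo (-t) t, φ i x * (c • g : Lp ℝ 2 (volume.restrict (Ioo (-t) t))) x =
      c * ∫ x in Ioo (-t) t, φ i x * g x := by
  rw [← integral_const_mul]
  refine integral_congr_ae ?_
  filter_upwards [Lp.coeFn_smul c g] with x hx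
  rw [hx, Pi.smul_apply, smul_eq_mul]; ring

/-- The Ritz function `u_S = Σ uᵢ φᵢ` is in `L²(S)`. -/
theorem memLp_ritz (hφm : ∀ i, Measurable (φ i)) (hφb : ∀ i x, |φ i x| ≤ B) (u : Fin n → ℝ) :
    MemLp (fun x => ∑ i, u i * φ i x) 2 (volume.restrict (Ioo (-t) t)) := by
  have h : ∀ i, MemLp (fun x => u i * φ i x) 2 (volume.restrict (Ioo (-t) t)) := fun i =>
    (MemLp.of_bound (hφm i).aestronglyMeasurable B (Filter.Eventually.of_forall fun x => by
      rw [Real.norm_eq_abs]; exact hφb i x) : MemLp (φ i) 2 (volume.restrict (Ioo (-t) t))).const_mul (u i)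
  convert memLp_finsetSum' (Finset.univ : Finset (Fin n)) (fun i _ => h i) using 1
  funext x
  simp only [Finset.sum_apply]

/-- `∫_S (Σ uᵢφᵢ)² = Σ uᵢ²` for an orthonormal family. [folklore] -/
theorem integral_ritz_sq (hφm : ∀ i, Measurable (φ i)) (hφb : ∀ i x, |φ i x| ≤ B)
    (horth : ∀ i j, ∫ x in Ioo (-t) t, φ i x * φ j x = if i = j then 1 else 0) (u : Fin n → ℝ) :
    ∫ x in Ioo (-t) t, (∑ i, u i * φ i x) ^ 2 = ∑ i, u i ^ 2 := by
  have hint : ∀ i j, Integrable (fun x => φ i x * φ j x) (volume.restrict (Ioo (-t) t)) := by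
    intro i j
    have hae : AEStronglyMeasurable (fun x => φ i x * φ j x) (volume.restrict (Ioo (-t) t)) :=
      ((hφm i).mul (hφm j)).aestronglyMeasurable
    have hB : 0 ≤ B := le_trans (abs_nonneg _) (hφb i 0)
    refine (MemLp.of_bound hae (B * B) (Filter.Eventually.of_forall fun x => ?_) : MemLp _ 1 _).integrable le_rfl
    rw [Real.norm_eq_abs, abs_mul]
    exact mul_le_mul (hφb i x) (hφb j x) (abs_nonneg _) hB
  have hexp : (fun x => (∑ i, u i * φ i x) ^ 2) = fun x => ∑ i, ∑ j, (u i * u j) * (φ i x * φ j x) := by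
    funext x
    rw [sq, Finset.sum_mul_sum]
    exact Finset.sum_congr rfl fun i _ => Finset.sum_congr rfl fun j _ => by ring
  rw [hexp, integral_finsetSum _ fun i _ => integrable_finsetSum _ fun j _ => (hint i j).const_mul _]
  have h2 : ∀ i, ∫ x in Ioo (-t) t, ∑ j, u i * u j * (φ i x * φ j x) = u i ^ 2 := by
    intro i
    rw [integral_finsetSum _ fun j _ => (hint i j).const_mul _]
    simp_rw [integral_const_mul, horth]
    simp [sq]
  exact Finset.sum_congr rfl fun i _ => h2 i

/-- `‖[g]‖² = ∫_S g²`. -/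
theorem norm_toLp_sq {g : ℝ → ℝ} (hg : MemLp g 2 (volume.restrict (Ioo (-t) t))) :
    ‖hg.toLp g‖ ^ 2 = ∫ x in Ioo (-t) t, g x ^ 2 := by
  rw [norm_toLp_sq_eq_integral_norm_sq]
  refine integral_congr_ae (Filter.Eventually.of_forall fun x => ?_)
  simp only [Real.norm_eq_abs, sq_abs]

/-- `‖g‖² = ∫_S g²` for `g ∈ L²(S)`. -/
theorem norm_Lp_sq (g : Lp ℝ 2 (volume.restrict (Ioo (-t) t))) : ‖g‖ ^ 2 = ∫ x in Ioo (-t) t, (g x) ^ 2 := by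
  rw [norm_sq_eq_integral_norm_sq]
  refine integral_congr_ae (Filter.Eventually.of_forall fun x => ?_)
  simp only [Real.norm_eq_abs, sq_abs]

end Galerkin

/-! ## The assembled certificate -/

/-- **Temple certificate for the window operator from Galerkin data** (RH-free, K-general; the logic of the
rh-dbr ET1e sharp enclosures): `K` continuous; `φ₁…φₙ` bounded measurable orthonormal on `S = (−t,t)`; `M` any
matrix whose form is `≤ a₀` on `u^⊥` (`u` a unit vector; in practice `M` = an enclosure of the Galerkin matrix
deflated at its top Ritz vector `u`, `a₀ ≥ λ₂`), finite-rank remainder `∫∫(K − ΣMφφ)² ≤ δ²`; and three certified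
integrals of the Ritz function `u_S = Σ uᵢφᵢ`: `η₁ ≤ ∫ u_S 𝖪u_S ≤ η₂`, `∫ (𝖪u_S)² ≤ ρ₂`, with `a₀ + δ < η₁`,
`0 < η₁`.  Then EVERY `f ∈ L²(S)` obeys `∫_S f 𝖪f ≤ (η₂ + (ρ₂ − η₁²)/(η₁ − a₀ − δ)) ∫_S f²` — Temple's
inequality with `a = a₀ + δ ≥ λ₂(𝖪[t])`.  [folklore: Temple 1928, Kato 1949; cite: ReedSimonIV1978, Thm XIII.44] -/
theorem quadForm_le_of_temple_galerkin_certificate (hK : Continuous K) {t : ℝ} {n : ℕ}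
    {φ : Fin n → ℝ → ℝ} (hφm : ∀ i, Measurable (φ i)) {B : ℝ} (hφb : ∀ i x, |φ i x| ≤ B)
    (horth : ∀ i j, ∫ x in Ioo (-t) t, φ i x * φ j x = if i = j then 1 else 0)
    (M : Matrix (Fin n) (Fin n) ℝ) (u : Fin n → ℝ) (hu : ∑ i, u i ^ 2 = 1)
    {a₀ δ η₁ η₂ ρ₂ : ℝ} (ha₀ : 0 ≤ a₀) (hδ : 0 < δ)
    (hM : ∀ c : Fin n → ℝ, ∑ i, u i * c i = 0 → ∑ i, ∑ j, c i * M i j * c j ≤ a₀ * ∑ i, c i ^ 2)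
    (hD : ∫ x in Ioo (-t) t, ∫ y in Ioo (-t) t,
      (K (x + y) - ∑ i, ∑ j, M i j * φ i x * φ j y) ^ 2 ≤ δ ^ 2)
    (hη₁ : η₁ ≤ ∫ x in Ioo (-t) t, (∑ i, u i * φ i x) * ∫ y in Ioo (-t) t, K (x + y) * ∑ i, u i * φ i y)
    (hη₂ : ∫ x in Ioo (-t) t, (∑ i, u i * φ i x) * ∫ y in Ioo (-t) t, K (x + y) * ∑ i, u i * φ i y ≤ η₂)
    (hρ₂ : ∫ x in Ioo (-t) t, (∫ y in Ioo (-t) t, K (x + y) * ∑ i, u i * φ i y) ^ 2 ≤ ρ₂)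
    (ha : a₀ + δ < η₁) (hpos : 0 < η₁)
    {f : ℝ → ℝ} (hf : MemLp f 2 (volume.restrict (Ioo (-t) t))) :
    ∫ x in Ioo (-t) t, f x * ∫ y in Ioo (-t) t, K (x + y) * f y ≤
      (η₂ + (ρ₂ - η₁ ^ 2) / (η₁ - (a₀ + δ))) * ∫ x in Ioo (-t) t, f x ^ 2 := by
  obtain ⟨T, hA⟩ := exists_winOp hK t
  have hsym := winOp_symm hK hA
  have hc := isCompactOperator_winOp hK hA
  -- the codimension-one functional L g = Σ uᵢ ∫ φᵢ g
  let L : Lp ℝ 2 (volume.restrict (Ioo (-t) t)) →ₗ[ℝ] ℝ :=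
    { toFun := fun g => ∑ i, u i * ∫ x in Ioo (-t) t, φ i x * g x
      map_add' := fun g h => by
        rw [← Finset.sum_add_distrib]
        exact Finset.sum_congr rfl fun i _ => by rw [integral_mul_Lp_add hφm hφb i g h, mul_add]
      map_smul' := fun c g => by
        rw [RingHom.id_apply, smul_eq_mul, Finset.mul_sum]
        exact Finset.sum_congr rfl fun i _ => by rw [integral_mul_Lp_smul i c g]; ring }
  have hL_apply : ∀ g, L g = ∑ i, u i * ∫ x in Ioo (-t) t, φ i x * g x := fun g => rfl
  -- the codimension-one premise
  have hL : ∀ g : Lp ℝ 2 (volume.restrict (Ioo (-t) t)), L g = 0 → ⟪T g, g⟫ ≤ (a₀ + δ) * ‖g‖ ^ 2 := by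
    intro g hg
    rw [inner_winOp_eq hA, norm_Lp_sq]
    exact quadForm_le_of_galerkin_certificate_on_ker hK hφm hφb horth M u ha₀ hδ hM hD (Lp.memLp g)
      (by rw [hL_apply] at hg; exact hg)
  -- the Ritz element
  have huS := memLp_ritz (t := t) hφm hφb u
  have huE1 : ‖huS.toLp _‖ = 1 := by
    have h2 : ‖huS.toLp _‖ ^ 2 = 1 := by rw [norm_toLp_sq, integral_ritz_sq hφm hφb horth u, hu]
    have h0 : 0 ≤ ‖huS.toLp _‖ := norm_nonneg _
    nlinarith [h2, h0]
  have hin : ⟪T (huS.toLp _), huS.toLp _⟫ =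
      ∫ x in Ioo (-t) t, (∑ i, u i * φ i x) * ∫ y in Ioo (-t) t, K (x + y) * ∑ i, u i * φ i y :=
    inner_winOp_toLp hA huS
  have hη₁' : η₁ ≤ ⟪T (huS.toLp _), huS.toLp _⟫ := by rw [hin]; exact hη₁
  have hη₂' : ⟪T (huS.toLp _), huS.toLp _⟫ ≤ η₂ := by rw [hin]; exact hη₂
  have hnormTu : ‖T (huS.toLp _)‖ ^ 2 ≤ ρ₂ := by rw [norm_winOp_toLp_sq hA huS]; exact hρ₂
  have hr₂' : ‖T (huS.toLp _)‖ ^ 2 - ⟪T (huS.toLp _), huS.toLp _⟫ ^ 2 ≤ ρ₂ - η₁ ^ 2 := by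
    have h1 : η₁ ^ 2 ≤ ⟪T (huS.toLp _), huS.toLp _⟫ ^ 2 := by nlinarith [hη₁', hpos]
    linarith
  have h := inner_le_temple_certificate T hsym hc L hL huE1 hη₁' hη₂' hr₂' ha hpos (hf.toLp f)
  rw [inner_winOp_toLp hA hf, norm_toLp_sq] at h
  exact h

end Summit.RiemannHypothesis.RiemannHypothesis.Theorems.SuzukiWindowsDoorTempleGalerkin
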